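import Summits.BirchSwinnertonDyer.BirchSwinnertonDyer.Theorems.ThetaPartnerAtTwoSignedControlAtTwoH1SigmaRankOne
import Literature.NumberTheory.EllipticCurves.H1SigmaDualFiniteProofs
import Literature.NumberTheory.EllipticCurves.IwasawaNakayamaProofs
import HarnessLib

/-!
# Road (b″) of crux C2 `MainConjectureOfRankZeroBSDAtTwo` (stmt-BirchSwinnertonDyer-22298), line `birth`:
# EVERY pinned dual of EVERY `conj`-stable subgroup of `H¹(K_Σ/K_∞, E[p^∞])` is a finitely generated `Λ`-module

HONEST FRAMING (cell `bsd-f1-sign2`, attach seat `bsd-line-att-p4` g5, route `AlignedTransportAtTwo`; BSD is NOT proved by any of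
this; the crux C2 stays OPEN). THEOREMS ONLY; `--supports stmt-BirchSwinnertonDyer-22298`, C2-NEUTRAL.

WHAT. The siblings `…FineRoadArchReceptacle` (relaxed Selmer dual over `ℚ_∞`, p614495) and `…FineRoadRelaxedFineFinite` (relaxed
fine Selmer dual over any `K_∞`, p615410) both run ONE argument: a `conj_γ`-stable subgroup `S ≤ H¹(K_∞, E[p^∞])` of classes
unramified outside a finite set has `S[𝔪] = {s | p s = 0, conj_γ s = s}` finite (tree `finite_setOf_unramifiedOutside_pTorsion_conjH1_eq`,
Greenberg LNM 1716 p. 117), hence every `Λ`-module pinned to `Hom(S, ℚ/ℤ)` (additive bijection + the `T`- and `C`-compatibilities) is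
finitely generated by the dual Nakayama lemma (`IwasawaDual.IsDualPair.module_finite`). This file states that argument ONCE, for an
ARBITRARY such `S` — so that any future receptacle over `ker κ` (Selmer, fine, relaxed, signed, non-primitive, …) inherits finite
generation by a one-line specialisation:

* `finite_setOf_pTorsion_conjH1_eq_of_le_unramifiedOutside` — `S[𝔪]` is finite;
* `module_finite_of_pinned_of_le_unramifiedOutside` — every pinned dual of `S` is `Module.Finite Λ`;
* `exists_pinned_of_conj_stable` — a pinned dual of `S` exists (canonical character module, `IsLocNil.module`);
* `module_finite_of_pinned_selmerInfty` — specialisation to `S = Sel_{p^∞}(E/K_∞)` for ANY pinned dual (not only a `SelmerDualData`: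
  the structure's `conj_mem` field is not needed), recovering `SelmerDualData.module_finite_of_…`.

References: R. Greenberg, LNM 1716 (1999), §1 p. 60 and p. 117; S. Lang, *Cyclotomic Fields I–II*, Ch. 5 §1; J. Silverman, AEC X.4.3.
-/

set_option autoImplicit false
-- the Theorems namespace of this sub repeats the summit name by design (D-0017 nested layout)
set_option linter.dupNamespace false

noncomputable section

open scoped Classical

namespace Summit.BirchSwinnertonDyer.BirchSwinnertonDyer.Theorems.AlignedTransportAtTwoFineRoad.PinnedDualFinite

open NumberField IsDedekindDomain Field WeierstrassCurve
open Literature.NumberTheory.EllipticCurves Literature.NumberTheory.EllipticCurves.IwasawaAlgebra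
  Literature.NumberTheory.EllipticCurves.GreenbergVatsal2000 Literature.NumberTheory.GaloisRepresentations ZpExtension

universe u

variable {K : Type u} [Field K] [NumberField K] (W : WeierstrassCurve K) {p : ℕ} [Fact p.Prime] (κ : ZpExtension K p)
  {γ : Field.absoluteGaloisGroup K}

/-- **`S[𝔪]` is finite** for every subgroup `S ≤ H¹(K_∞, E[p^∞])` of classes unramified outside a finite set `S₀` (at every
conjugate; `GreenbergVatsal2000.unramifiedOutside`), `W` elliptic over the number field `K`, any prime `p`, any `ℤ_p`-extension `κ`
with topological generator `γ`: the set `{s ∈ S | p s = 0, conj_γ s = s}` is finite (subset of `H¹(K_Σ/K_∞, E[p^∞])[𝔪]`, tree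
`finite_setOf_unramifiedOutside_pTorsion_conjH1_eq`). [cite: GreenbergLNM1716, §1 p. 60 and §4 p. 117] [cite: SilvermanAEC2009, Lemma X.4.3] -/
theorem finite_setOf_pTorsion_conjH1_eq_of_le_unramifiedOutside [W.IsElliptic] (hγ : κ.IsTopGenerator γ)
    {S : AddSubgroup (W.subgroupH1 p κ.kerSubgroup)} {S₀ : Set (HeightOneSpectrum (𝓞 K))} (hS₀ : S₀.Finite)
    (hle : S ≤ unramifiedOutside κ.kerSubgroup (W.geomPrimaryTorsion p) p S₀) :
    Set.Finite {s : S | p • s = 0 ∧ W.conjH1 p κ.kerSubgroup γ (s : W.subgroupH1 p κ.kerSubgroup) = s} := by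
  have hfin := W.finite_setOf_unramifiedOutside_pTorsion_conjH1_eq (p := p) κ hγ hS₀
  refine (hfin.preimage Subtype.val_injective.injOn).subset ?_
  rintro s ⟨hsp, hsγ⟩
  refine ⟨hle s.2, ?_, hsγ⟩
  have h1 := congrArg (fun z : S ↦ (z : W.subgroupH1 p κ.kerSubgroup)) hsp
  simpa using h1

/-- **Every pinned dual of a `conj_γ`-stable `S ≤ H¹(K_Σ/K_∞, E[p^∞])` is a finitely generated `Λ`-module.** For `γ` a topological
generator, `S` stable under `conj_γ` and unramified outside a finite `S₀`, and ANY `Λ = ℤ_p⟦T⟧`-module `X` with an additive bijection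
`toDual : X ≅ Hom(S, ℚ/ℤ)` under which `T` acts as `conj_γ − 1` and constants through `ℤ_p → ℤ/p^k`: `Module.Finite Λ X` (dual Nakayama,
`IwasawaDual.IsDualPair.module_finite`; local nilpotence from `isLocNil_sub_one_of_coe_eq_conjH1`). The receptacle-generic form of
`SelmerDualData.module_finite_of_…`, `FineSelmerDualData.module_finite`, `ArchReceptacle.module_finite_of_pinned`,
`RelaxedFineFinite.module_finite_fineRelaxedInf`. [cite: Lang1990, Ch. 5 §1 (Nakayama's lemma)] [cite: GreenbergLNM1716, §1 p. 60 (after Conj. 1.3)] -/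
theorem module_finite_of_pinned_of_le_unramifiedOutside [W.IsElliptic] (hγ : κ.IsTopGenerator γ)
    {S : AddSubgroup (W.subgroupH1 p κ.kerSubgroup)} (hS : ∀ s ∈ S, W.conjH1 p κ.kerSubgroup γ s ∈ S)
    {S₀ : Set (HeightOneSpectrum (𝓞 K))} (hS₀ : S₀.Finite)
    (hle : S ≤ unramifiedOutside κ.kerSubgroup (W.geomPrimaryTorsion p) p S₀)
    {X : Type*} [AddCommGroup X] [_root_.Module (IwasawaAlgebra p) X] (toDual : X →+ (S →+ AddCircle (1 : ℚ)))
    (hbij : Function.Bijective toDual)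
    (hT : ∀ (x : X) (s : S), toDual ((PowerSeries.X : IwasawaAlgebra p) • x) s =
      toDual x ⟨W.conjH1 p κ.kerSubgroup γ s, hS _ s.2⟩ - toDual x s)
    (hC : ∀ (c : ℤ_[p]) (x : X) (s : S) (k : ℕ), (p ^ k) • s = 0 →
      toDual (PowerSeries.C c • x) s = (PadicInt.toZModPow k c).val • toDual x s) :
    Module.Finite (IwasawaAlgebra p) X := by
  let φ : AddMonoid.End S :=
    AddMonoidHom.mk' (fun c ↦ ⟨W.conjH1 p κ.kerSubgroup γ c, hS _ c.2⟩)
      (fun a b ↦ Subtype.ext (by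
        change W.conjH1 p κ.kerSubgroup γ ((a : W.subgroupH1 p κ.kerSubgroup) + b) =
          W.conjH1 p κ.kerSubgroup γ a + W.conjH1 p κ.kerSubgroup γ b
        exact map_add _ _ _))
  have hφ : ∀ s, ((φ s : S) : W.subgroupH1 p κ.kerSubgroup) = W.conjH1 p κ.kerSubgroup γ s := fun _ ↦ rfl
  have h := W.isLocNil_sub_one_of_coe_eq_conjH1 κ hγ _ φ hφ
  have hpair : IwasawaDual.IsDualPair p (φ - 1) toDual :=
    { bijective := hbij
      T_smul := fun x s ↦ by
        rw [hT, IwasawaDual.End_sub_apply, AddMonoid.End.one_apply, map_sub]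
        rfl
      C_smul := fun c x s k hk ↦ hC c x s k hk
      locNil := h }
  refine hpair.module_finite ((finite_setOf_pTorsion_conjH1_eq_of_le_unramifiedOutside W κ hγ hS₀ hle).subset ?_)
  intro s hs
  obtain ⟨hs1, hs2⟩ := hs
  rw [pow_one] at hs1 hs2
  rw [IwasawaDual.End_sub_apply, AddMonoid.End.one_apply, sub_eq_zero] at hs2
  refine ⟨hs1, ?_⟩
  have h2 := congrArg (fun z : S ↦ (z : W.subgroupH1 p κ.kerSubgroup)) hs2
  simpa [hφ] using h2

omit [NumberField K] in
/-- **A pinned dual of any `conj_γ`-stable `S ≤ H¹(K_∞, E[p^∞])` EXISTS** (`γ` a topological generator): the character group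
`Hom(S, ℚ/ℤ)` with the canonical `Λ`-structure `IwasawaDual.IsLocNil.module` (`T ↦ conj_γ − 1`). [cite: GreenbergLNM1716, §1 (after Conj. 1.3)]
[cite: Washington1997, §13.2] -/
theorem exists_pinned_of_conj_stable [NumberField K] (hγ : κ.IsTopGenerator γ)
    {S : AddSubgroup (W.subgroupH1 p κ.kerSubgroup)} (hS : ∀ s ∈ S, W.conjH1 p κ.kerSubgroup γ s ∈ S) :
    ∃ (X : Type u) (_ : AddCommGroup X) (_ : _root_.Module (IwasawaAlgebra p) X) (toDual : X →+ (S →+ AddCircle (1 : ℚ))),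
      Function.Bijective toDual ∧
      (∀ (x : X) (s : S), toDual ((PowerSeries.X : IwasawaAlgebra p) • x) s =
        toDual x ⟨W.conjH1 p κ.kerSubgroup γ s, hS _ s.2⟩ - toDual x s) ∧
      (∀ (c : ℤ_[p]) (x : X) (s : S) (k : ℕ), (p ^ k) • s = 0 →
        toDual (PowerSeries.C c • x) s = (PadicInt.toZModPow k c).val • toDual x s) := by
  let φ : AddMonoid.End S :=
    AddMonoidHom.mk' (fun c ↦ ⟨W.conjH1 p κ.kerSubgroup γ c, hS _ c.2⟩)
      (fun a b ↦ Subtype.ext (by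
        change W.conjH1 p κ.kerSubgroup γ ((a : W.subgroupH1 p κ.kerSubgroup) + b) =
          W.conjH1 p κ.kerSubgroup γ a + W.conjH1 p κ.kerSubgroup γ b
        exact map_add _ _ _))
  have hφ : ∀ s, ((φ s : S) : W.subgroupH1 p κ.kerSubgroup) = W.conjH1 p κ.kerSubgroup γ s := fun _ ↦ rfl
  have h := W.isLocNil_sub_one_of_coe_eq_conjH1 κ hγ _ φ hφ
  refine ⟨(S →+ AddCircle (1 : ℚ)), inferInstance, h.module, AddMonoidHom.id _, Function.bijective_id, fun x s ↦ ?_,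
    fun c x s k hk ↦ ?_⟩
  · show h.smulFun PowerSeries.X x s = x _ - x s
    rw [h.smulFun_X_apply, IwasawaDual.End_sub_apply, AddMonoid.End.one_apply, map_sub]
    rfl
  · show h.smulFun (PowerSeries.C c) x s = _
    exact h.smulFun_C_apply c x hk

/-- **Specialisation: every pinned dual of `Sel_{p^∞}(E/K_∞)` is finitely generated over `Λ`** — for ANY `ℤ_p`-extension of a number
field with topological generator `γ` and ANY `(X, toDual)` pinned to `W.selmerInfty κ` by a bijection with the two compatibilities
(no `SelmerDualData` structure needed). `Sel_∞ ⊆ H¹(K_Σ/K_∞, E[p^∞])` with `Σ₀` the bad places (tree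
`SignedEC.H1SigmaRank.selmerInfty_le_unramifiedOutside`). [cite: GreenbergLNM1716, §1 p. 60 (after Conj. 1.3)] -/
theorem module_finite_of_pinned_selmerInfty [W.IsElliptic] (hγ : κ.IsTopGenerator γ)
    {X : Type*} [AddCommGroup X] [_root_.Module (IwasawaAlgebra p) X] (toDual : X →+ (W.selmerInfty κ →+ AddCircle (1 : ℚ)))
    (hbij : Function.Bijective toDual)
    (hT : ∀ (x : X) (s : W.selmerInfty κ), toDual ((PowerSeries.X : IwasawaAlgebra p) • x) s =
      toDual x ⟨W.conjH1 p κ.kerSubgroup γ s, W.map_conjH1_selmerGroupOver_le_holds p κ.kerSubgroup γ ⟨s, s.2, rfl⟩⟩ - toDual x s)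
    (hC : ∀ (c : ℤ_[p]) (x : X) (s : W.selmerInfty κ) (k : ℕ), (p ^ k) • s = 0 →
      toDual (PowerSeries.C c • x) s = (PadicInt.toZModPow k c).val • toDual x s) :
    Module.Finite (IwasawaAlgebra p) X :=
  module_finite_of_pinned_of_le_unramifiedOutside W κ hγ
    (fun s hs ↦ W.map_conjH1_selmerGroupOver_le_holds p κ.kerSubgroup γ ⟨s, hs, rfl⟩) (W.finite_badPlaces_holds (𝓞 K))
    (Summit.BirchSwinnertonDyer.BirchSwinnertonDyer.Theorems.SignedEC.H1SigmaRank.selmerInfty_le_unramifiedOutside W κ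
      (W.badPlaces (𝓞 K)) (fun v hv _ ↦ by by_contra h; exact hv h))
    toDual hbij hT hC

end Summit.BirchSwinnertonDyer.BirchSwinnertonDyer.Theorems.AlignedTransportAtTwoFineRoad.PinnedDualFinite

end
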